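import Mathlib
import HarnessLib
import Summits.NavierStokesRegularity.NavierStokesRegularity.Theorems.LocalIrrotationalScarDoorLocalPointZoomScarCurlRep
import Summits.NavierStokesRegularity.NavierStokesRegularity.Theorems.RellichScarApexLocalisationIrrotHalfspaceLiouville

/-!
# STAGED door S15 `LocalIrrotationalScarDoor` (nsreg-p1 ROUND-14) — THE DOOR ITSELF AS A TREE THEOREM

`localIrrotationalScarDoor_target` — the text of the route's `Target` (gate render
`HOME/ns-regularity-ideate-p1/route-irrotscar/bc/rendered-LocalIrrotationalScarDoor.lean`, item r0) proved VERBATIM: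
**a classical Leray–Hopf flow from rapidly decaying data which is LOCALLY SPACE–TIME Type I at `(x₀, T)`,
`‖u(t,x)‖ (‖x − x₀‖ + √(ν(T−t))) ≤ M` on `]T−ρ², T[ × B(x₀,ρ)`, and whose velocity has a pointwise final-time
trace on the half-ball side `{x ∈ B(x₀,ρ) | ⟪x − x₀, e⟫ > 0}` with `u(T,·) ∈ C¹` and `curl u(T,·) = 0` there, is
BACKWARD BOUNDED at `x₀`** — a space–time Type-I blow-up point is never a boundary point of a final-time
`C¹`-irrotational half-ball.

Proof = p1 g12's 15-line `glue.lean` (`closes`): instantiate the zoom crux K1Rep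
(`…LocalIrrotationalScarDoorLocalPointZoomScarCurlRep.localPointZoomScarCurlRep`, p6 g7) at the open, dilation-invariant
half-space `S = {y | 0 < ⟪y, e⟫}` (`0 ∉ S`) and contradict the residue K2Rep
(`…RellichScarApexLocalisationIrrotHalfspaceLiouville.not_isBackwardSingularPoint_of_topCurlVanishing_halfspace`,
p1 g12's kit landed by p6 g7).  So S15 is MOOT-BY-PROOF: at birth `Target`, `K1Rep`, `K2Rep`, `AssemblyRep` all close by
one-liners.

Sources: Escauriaza–Seregin–Šverák 2003 (backward uniqueness, Thm 1.4 / §3 / Thm 5.1); Albritton–Barker 2019 §3 and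
Seregin 2014 Prop. 6.20 (the zoom); Seregin–Šverák 2009 §2 (quantitative local regularity).
Seat nsreg-p6 g7 (anchor `--supports stmt-NavierStokesRegularity-11719` until the route is born).
WHAT THIS IS NOT: not NS regularity (Clay A) — a conditional criterion inside the space–time Type-I scenario; not a
route open.
-/

noncomputable section

open MeasureTheory Set Function Filter Topology TopologicalSpace Metric
open Literature.Analysis Literature.Analysis.FluidPDE
open Summit.NavierStokesRegularity.NavierStokesRegularity.Theorems.LocalIrrotationalScarDoorLocalPointZoomScarCurlRep
open Summit.NavierStokesRegularity.NavierStokesRegularity.Theorems.RellichScarApexLocalisationIrrotHalfspaceLiouville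
open scoped RealInnerProductSpace

-- the summit and its single sub-problem share the name (CONVENTIONS §1), as in every Theorems file
set_option linter.dupNamespace false

namespace Summit.NavierStokesRegularity.NavierStokesRegularity.Theorems.LocalIrrotationalScarDoorTargetTheorem

/-- **The irrotational-scar door S15** (text of the route's `Target`, verbatim): local space–time Type I at
`(x₀, T)` + a final-time velocity trace on a half-ball side that is `C¹` and IRROTATIONAL ⇒ backward bounded at
`x₀`. [cite: EscauriazaSereginSverak2003, Thm. 1.4, §3, Thm. 5.1] -/
theorem localIrrotationalScarDoor_target :
    ∀ (ν T : ℝ), 0 < ν → 0 < T → ∀ (u : ℝ → EuclideanSpace ℝ (Fin 3) → EuclideanSpace ℝ (Fin 3))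
      (p : ℝ → EuclideanSpace ℝ (Fin 3) → ℝ),
    Literature.Analysis.FluidPDE.IsClassicalNSSolutionOn (Set.Ico 0 T) ν 0 u p →
    Literature.Analysis.FluidPDE.IsLerayHopfOn T ν 0 (u 0) u →
    Literature.Analysis.FluidPDE.HasRapidSpatialDecay (u 0) →
    ∀ (x₀ e : EuclideanSpace ℝ (Fin 3)) (ρ M : ℝ), ‖e‖ = 1 → 0 < ρ →
    (∀ t ∈ Set.Ico 0 T, T - ρ ^ 2 < t → ∀ x ∈ Metric.ball x₀ ρ,
      ‖u t x‖ * (‖x - x₀‖ + Real.sqrt (ν * (T - t))) ≤ M) →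
    (∀ x ∈ Metric.ball x₀ ρ, 0 < inner ℝ (x - x₀) e →
      Filter.Tendsto (fun t => u t x) (nhdsWithin T (Set.Iio T)) (nhds (u T x))) →
    ContDiffOn ℝ 1 (u T) (Metric.ball x₀ ρ ∩ {x | 0 < inner ℝ (x - x₀) e}) →
    (∀ x ∈ Metric.ball x₀ ρ, 0 < inner ℝ (x - x₀) e → Literature.Analysis.FluidPDE.curl (u T) x = 0) →
    Literature.Analysis.FluidPDE.IsBackwardBoundedAt u T x₀ := by
  intro ν T hν hT u p hcl hLH hdec x₀ e ρ M he hρ hI htr hC1 hcurl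
  by_contra hbb
  have hopen : IsOpen {y : EuclideanSpace ℝ (Fin 3) | 0 < inner ℝ y e} :=
    isOpen_lt continuous_const (continuous_id.inner continuous_const)
  have hdil : ∀ y ∈ {y : EuclideanSpace ℝ (Fin 3) | 0 < inner ℝ y e}, ∀ c : ℝ, 0 < c →
      c • y ∈ {y : EuclideanSpace ℝ (Fin 3) | 0 < inner ℝ y e} := by
    intro y hy c hc
    simp only [Set.mem_setOf_eq] at hy ⊢
    rw [real_inner_smul_left]
    exact mul_pos hc hy
  have h0 : (0 : EuclideanSpace ℝ (Fin 3)) ∉ {y : EuclideanSpace ℝ (Fin 3) | 0 < inner ℝ y e} := by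
    simp [inner_zero_left]
  obtain ⟨C, w, π, H, Uc, hsw, hwg, hIw, hapex, hsing, hUc, hUcc, htopc⟩ :=
    localPointZoomScarCurlRep ν T hν hT u p hcl hLH hdec x₀ {y : EuclideanSpace ℝ (Fin 3) | 0 < inner ℝ y e} ρ M
      hopen hdil h0 hρ hI htr hC1 hcurl hbb
  exact not_isBackwardSingularPoint_of_topCurlVanishing_halfspace hsw hwg hIw hapex he hUc hUcc
    (fun x₁ hx₁ => htopc x₁ hx₁) hsing

end Summit.NavierStokesRegularity.NavierStokesRegularity.Theorems.LocalIrrotationalScarDoorTargetTheorem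

end
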